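import Summits.BirchSwinnertonDyer.BirchSwinnertonDyer.Theorems.Rank1ResidualJetThm63Stringent
import Summits.BirchSwinnertonDyer.BirchSwinnertonDyer.Theorems.Rank1ResidualJetLocalTransverse
import Summits.BirchSwinnertonDyer.BirchSwinnertonDyer.Theorems.Rank1ResidualJetWeilDatum
import HarnessLib

/-!
# T1 JET (cell `bsd-jet`), road K: the H63 line with EVERY structure-level parameter supplied —
# Weil datum (theorem), intrinsic transverse family with its reconciliation (theorem), stringent
# family with (δ) (theorem) — leaving named print, local print-to-type inputs and the three
# completion-layer gaps

HONEST FRAMING (programme file §HONESTY, verbatim): «no tranche here proves BSD; ARM L moves the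
LITERAL column of an r ≤ 1 census into the kernel-proved-modulo-named-print column.» THEOREMS ONLY
(seat `bsd-jet-pv-2`, session g4; `--supports stmt-BirchSwinnertonDyer-14418`, helper); 0 classes
move. WHAT THIS IS. `JET.tamagawaExponent_le_mInfty_of_localInputs_stringent` (p510455) with
* the Weil datum `e, hμ, hadd₁, hadd₂, hgal, halt, hnondeg, hτe` OBTAINED from
  `exists_weilDatum_liftAut` (p511679; transport of the tree's Weil pairing of `W/ℚ`);
* the transverse family `𝒯` and its reconciliation `hT` OBTAINED from `exists_localTransverseFamily`
  (p509971; the tree's intrinsic `transverseSubgroup (E[p^k]|K_v) (K[ℓ]_{w'})`), the two local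
  properties `τ`-stability / self-duality now stated for THAT explicit local object (`h𝒯σ`, `h𝒯sd`,
  quantified over Weil data for the latter) and `h49tr` likewise.
What is LEFT (the complete list): named print {`h44` [McC 4.4], `h53` Gross 5.3, `hGZ` [GZ86 III (3.1)],
`hPT` Poitou–Tate}; local print-to-type {`hloc` [J] Lemma 5.2 (i)(ii), `h𝒯sd` Howard 2004 Prop. 2.1.9 (ii),
`h𝒯σ` Gross §3 dihedral}; plumbing {`h𝒮σ`}; row data at the carrier place {minimality, `c_{v₀} ≠ 0`,
`Φ_{v₀}` cyclic, `v₀` split over `N`}; and the three completion-layer KERNEL GAPS {`htr`, `h49tr`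
(Howard 2004 Lemma 2.7.3 transverseness), `h49str` (Jetchev Prop. 4.9 proper)}. CONCLUSION
`ord_p c_{v₀}(E/K) ≤ m_∞`. References: [cite: Jetchev2008, Thm. 5.2 (p. 821), Lemma 3.2, Lemma 5.2,
Prop. 4.9, §3.1.2] [cite: Howard2004HeegnerKolyvagin, Prop. 2.1.7, Prop. 2.1.9, Lemma 2.7.3]
[cite: McCallumLMS1991, §4 Prop. 4.4] [cite: GrossLMS1991, §3, Prop. 5.3, Prop. 6.2 (1)]
[cite: GrossZagier1986, III (3.1)] [cite: MilneADT2006, Ch. I, Thm. 4.10(b)]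
[cite: SilvermanAEC2009, Prop. III.8.1].
-/

set_option autoImplicit false

noncomputable section

open scoped Classical Pointwise

open WeierstrassCurve IsDedekindDomain NumberField Field Literature.NumberTheory.EllipticCurves
  Literature.NumberTheory.EllipticCurves.ModularForms Literature.NumberTheory.EllipticCurves.Jetchev2008
  Literature.NumberTheory.GaloisRepresentations Literature.NumberTheory.GaloisCohomology
  Literature.NumberTheory.GaloisRepresentations.DiscreteGaloisModule
  Summit.BirchSwinnertonDyer.Rank1Residual.X11b Summit.BirchSwinnertonDyer.Rank1Residual.X11b.Three
  Summit.BirchSwinnertonDyer.Rank1Residual.JET.SelmerVocabulary Literature.NumberTheory.Automorphic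

namespace Summit.BirchSwinnertonDyer.Rank1Residual.JET

/-- **[J] Thm 5.2 at a core vertex with every structure-level parameter supplied by tree theorems**
(Weil datum p511679, intrinsic transverse family p509971, stringent family + (δ) p510455); see the
module docstring for the complete list of what remains. CONCLUSION: `ord_p c_{v₀}(E/K) ≤ m_∞`.
[cite: Jetchev2008, Thm. 5.2 (p. 821) and proof (pp. 821–823)] [cite: Howard2004HeegnerKolyvagin,
Prop. 2.1.9, Lemma 2.7.3] [cite: McCallumLMS1991, §4 Prop. 4.4] [cite: GrossLMS1991, Prop. 5.3]
[cite: GrossZagier1986, III (3.1)] [cite: MilneADT2006, Ch. I, Thm. 4.10(b)] -/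
theorem tamagawaExponent_le_mInfty_of_localFacts
    (h44 : McCallum1991.prop44_localOrder_kolyvaginClass_mul_eq)
    (W : WeierstrassCurve ℚ) [W.IsElliptic] [W.IsGloballyMinimal] [NeZero (W.conductorNorm ℤ)]
    (hcm : ¬ W.HasCM) (K : Type) [Field K] [NumberField K] (hK : IsImaginaryQuadratic K)
    (hD3 : NumberField.discr K ≠ -3) (hD4 : NumberField.discr K ≠ -4)
    (hH : SatisfiesHeegnerHypothesis (W.conductorNorm ℤ) K)
    (hPT : poitouTate_selmerStructure_duality_conj K)
    (p : ℕ) [Fact p.Prime] (hp2 : p ≠ 2) (htower : ∀ n : ℕ, W.HasSurjectiveModNGaloisRep (p ^ n : ℕ))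
    (Dt : ModularParametrizationData W (W.conductorNorm ℤ)) (β : ℤ) (ι : K →+* ℂ)
    [∀ j : ℕ, NumberField (ringClassField K ι j)]
    (τ : K ≃ₐ[ℚ] K) (hτ : τ ≠ 1) (hτ2 : τ * τ = 1)
    (ε : ℤ) (hε : ε = 1 ∨ ε = -1)
    (h53 : ∀ (m : ℕ) (dm : KolyvaginHeegnerData Dt β ι m)
      (τm : ringClassField K ι m ≃ₐ[ℚ] ringClassField K ι m),
      (∀ x : ringClassField K ι m, ((τm x : ringClassField K ι m) : ℂ) = starRingEnd ℂ x) →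
      ∃ σ' ∈ ringClassGal ι m, IsOfFinAddOrder
        (pointGalHom W (ringClassField K ι m) τm dm.y -
          ε • pointGalHom W (ringClassField K ι m) σ' dm.y))
    {n' : ℤ} (hcop' : IsCoprime (p : ℤ) n')
    (hGZ : ∀ (m : ℕ) (dm : KolyvaginHeegnerData Dt β ι m)
      (γ : ringClassField K ι m ≃ₐ[ℚ] ringClassField K ι m), γ ∈ ringClassGal ι m →
      ∀ v : HeightOneSpectrum (𝓞 K), ¬ (W.baseChange K).HasGoodReductionAt v →
        n' • pointsMap (W.baseChange K) (v.adicCompletion K)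
            (dm.toGeomPoints (pointGalHom W (ringClassField K ι m) γ dm.y)) ∈
          E0Receptacle (W.baseChange K) v ∧
        ∀ (ℓ : ℕ), ℓ ∈ m.primeFactors → ∀ (dm' : KolyvaginHeegnerData Dt β ι (m / ℓ))
          (hle : ringClassField K ι (m / ℓ) ≤ ringClassField K ι m),
          n' • pointsMap (W.baseChange K) (v.adicCompletion K)
              (dm.toGeomPoints (pointGalHom W (ringClassField K ι m) γ
                (WeierstrassCurve.Affine.Point.map (W' := W)
                  ((RingClassField.inclusion ι hle).restrictScalars ℚ) dm'.y))) ∈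
            E0Receptacle (W.baseChange K) v)
    (mdiv m : {c : ℕ // Squarefree c ∧ ∀ ℓ ∈ c.primeFactors,
        Zhang2014.IsKolyvaginPrime (W.conductorNorm ℤ) W K p ℓ} → ℕ∞)
    (hmdiv : ∀ c (u : ℕ), (u : ℕ∞) ≤ mdiv c ↔ ∀ d : KolyvaginHeegnerData Dt β ι c.1,
      ∃ Q : (W.baseChange (ringClassField K ι c.1)).toAffine.Point,
        ((p ^ u : ℕ) : ℤ) • Q = d.derivedPoint)
    (hm : ∀ c, m c = if mdiv c < Zhang2014.levelIndex W p c.1 then mdiv c else ⊤)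
    (k : ℕ) [NeZero (p ^ k)] [Finite (geomTorsion (W.baseChange K) ((p ^ k : ℕ) : ℤ))]
    (hn : ((p ^ k : ℕ) : ℤ) ≠ 0)
    (c : {c : ℕ // Squarefree c ∧ ∀ ℓ ∈ c.primeFactors,
        Zhang2014.IsKolyvaginPrime (W.conductorNorm ℤ) W K p ℓ}) (hk : 1 ≤ k)
    (hcore : IsGlobalCoreVertex W K ι τ p k c.1) (mInf : ℕ) (hmc : m c = mInf)
    (hkM : (k : ℕ∞) + mInf ≤ Zhang2014.levelIndex W p c.1) (hik : mInf < k)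
    -- ROW DATA at the carrier place `v₀`
    (v₀ : HeightOneSpectrum (𝓞 K)) (hv₀ : τ • v₀ ≠ v₀)
    (hv₀N : ((W.conductorNorm ℤ : ℕ) : 𝓞 K) ∈ v₀.asIdeal)
    [hmin : ((W.baseChange K).baseChange (v₀.adicCompletion K)).IsMinimal (v₀.adicCompletionIntegers K)]
    (hc0 : ((W.baseChange K).baseChange (v₀.adicCompletion K)).localTamagawaNumber
      (v₀.adicCompletionIntegers K) ≠ 0)
    [hΦ : IsAddCyclic (((W.baseChange K).baseChange (v₀.adicCompletion K)).toAffine.Point ⧸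
      ((W.baseChange K).baseChange (v₀.adicCompletion K)).goodReductionSubgroup (v₀.adicCompletionIntegers K))]
    (htk : (((W.baseChange K).baseChange (v₀.adicCompletion K)).localTamagawaNumber
      (v₀.adicCompletionIntegers K)).factorization p < k)
    -- LOCAL PRINT-TO-TYPE: the intrinsic transverse condition is `τ`-stable (Gross §3 dihedral)
    (h𝒯σ : ∀ (𝒯 : SelmerStructure ((W.baseChange K).torsionGaloisModule ((p ^ k : ℕ) : ℤ))),
      (∀ v : HeightOneSpectrum (𝓞 K), 𝒯 (Sum.inr v) =
        ⨅ ℓ ∈ c.1.primeFactors.filter (fun ℓ : ℕ ↦ ((ℓ : ℕ) : 𝓞 K) ∈ v.asIdeal),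
          ⨅ (w' : HeightOneSpectrum (𝓞 (ringClassField K ι ℓ))) (_ : w'.asIdeal.LiesOver v.asIdeal),
            letI := (adicCompletionOfLiesOver K (ringClassField K ι ℓ) v w').toAlgebra
            transverseSubgroup (GaloisRep.toLocal v ((W.baseChange K).torsionGaloisModule ((p ^ k : ℕ) : ℤ)))
              (w'.adicCompletion (ringClassField K ι ℓ))) →
      ∀ (v w : HeightOneSpectrum (𝓞 K)) (h : τ • v = w), v ∈ placesDividing K c.1 →
      ∀ x : galoisCohomology (((W.baseChange K).torsionGaloisModule ((p ^ k : ℕ) : ℤ)).toLocal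
        (Sum.inr v : Place K)) 1,
      x ∈ 𝒯 (Sum.inr v) → conjActPlace W τ ((p ^ k : ℕ) : ℤ) h x ∈ 𝒯 (Sum.inr w))
    -- LOCAL PRINT-TO-TYPE: the intrinsic transverse condition is Lagrangian (Howard 2.1.9 (ii))
    (h𝒯sd : ∀ (𝒯 : SelmerStructure ((W.baseChange K).torsionGaloisModule ((p ^ k : ℕ) : ℤ))),
      (∀ v : HeightOneSpectrum (𝓞 K), 𝒯 (Sum.inr v) =
        ⨅ ℓ ∈ c.1.primeFactors.filter (fun ℓ : ℕ ↦ ((ℓ : ℕ) : 𝓞 K) ∈ v.asIdeal),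
          ⨅ (w' : HeightOneSpectrum (𝓞 (ringClassField K ι ℓ))) (_ : w'.asIdeal.LiesOver v.asIdeal),
            letI := (adicCompletionOfLiesOver K (ringClassField K ι ℓ) v w').toAlgebra
            transverseSubgroup (GaloisRep.toLocal v ((W.baseChange K).torsionGaloisModule ((p ^ k : ℕ) : ℤ)))
              (w'.adicCompletion (ringClassField K ι ℓ))) →
      ∀ (e : geomTorsion (W.baseChange K) ((p ^ k : ℕ) : ℤ) →
          geomTorsion (W.baseChange K) ((p ^ k : ℕ) : ℤ) → AlgebraicClosure K)
        (hμ : ∀ S T, e S T ^ (p ^ k) = 1)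
        (hadd₁ : ∀ S₁ S₂ T, e (S₁ + S₂) T = e S₁ T * e S₂ T)
        (hadd₂ : ∀ S T₁ T₂, e S (T₁ + T₂) = e S T₁ * e S T₂)
        (hgal : ∀ (g : absoluteGaloisGroup K) (S T : geomTorsion (W.baseChange K) ((p ^ k : ℕ) : ℤ)),
          g • e S T = e (g • S) (g • T)),
      (∀ T, e T T = 1) → (∀ T, (∀ S, e S T = 1) → T = 0) →
      ∀ inv : LocalInvariants K (p ^ k), inv.IsPerfect → ∀ v ∈ placesDividing K c.1,
      inv.dualTransported 𝒯 (weilDualIntertwining (W.baseChange K) (p ^ k) e hμ hadd₁ hadd₂ hgal)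
        (Sum.inr v) = 𝒯 (Sum.inr v))
    -- PLUMBING: the stringent family is `τ`-stable at the carrier pair
    (h𝒮σ : ∀ (v w : HeightOneSpectrum (𝓞 K)) (h : τ • v = w), v ∈ ({v₀, τ • v₀} : Finset _) →
      ∀ x : galoisCohomology (((W.baseChange K).torsionGaloisModule ((p ^ k : ℕ) : ℤ)).toLocal
        (Sum.inr v : Place K)) 1,
      x ∈ stringentFamily W K hn (Sum.inr v) →
        conjActPlace W τ ((p ^ k : ℕ) : ℤ) h x ∈ stringentFamily W K hn (Sum.inr w))
    -- LOCAL PRINT-TO-TYPE (Lemma 5.2 (i)–(ii)) at the Kolyvagin primes `λ ∤ c`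
    (hloc : ∀ ℓ : ℕ, Zhang2014.IsKolyvaginPrime (W.conductorNorm ℤ) W K p ℓ →
      k ≤ Zhang2014.kolyvaginIndex W p ℓ → ℓ ∉ c.1.primeFactors →
      ∀ (v : HeightOneSpectrum (𝓞 K)), (ℓ : 𝓞 K) ∈ v.asIdeal → ∀ (hfix : τ • v = v)
        (s : ℤ), s = 1 ∨ s = -1 →
      ((W.baseChange K).kummerSelmerStructure ((p ^ k : ℕ) : ℤ) (Sum.inr v)).relIndex
        ((conjActPlace W τ ((p ^ k : ℕ) : ℤ) hfix - s • AddMonoidHom.id _).ker) = p ^ k)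
    -- KERNEL GAPS (completion layer)
    (htr : ∀ (d : KolyvaginHeegnerData Dt β ι c.1), ∀ ℓ ∈ c.1.primeFactors,
      (d.kolyvaginClass (Fact.out : p.Prime) k :
        galoisCohomology ((W.baseChange K).torsionGaloisModule ((p ^ k : ℕ) : ℤ)) 1) ∈
        transverseKer W K ι ((p ^ k : ℕ) : ℤ) ℓ)
    (h49str : ∀ (ℓ : ℕ), Zhang2014.IsKolyvaginPrime (W.conductorNorm ℤ) W K p ℓ →
      k ≤ Zhang2014.kolyvaginIndex W p ℓ → ℓ ∉ c.1.primeFactors →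
      ∀ (d' : KolyvaginHeegnerData Dt β ι (c.1 * ℓ)), ∀ q ∈ ({v₀, τ • v₀} : Finset _),
      galoisCohomology.localization ((W.baseChange K).torsionGaloisModule ((p ^ k : ℕ) : ℤ))
          (Sum.inr q) 1 (d'.kolyvaginClass (Fact.out : p.Prime) k) ∈ stringentFamily W K hn (Sum.inr q))
    (h49tr : ∀ (ℓ : ℕ), Zhang2014.IsKolyvaginPrime (W.conductorNorm ℤ) W K p ℓ →
      k ≤ Zhang2014.kolyvaginIndex W p ℓ → ℓ ∉ c.1.primeFactors →
      ∀ (d' : KolyvaginHeegnerData Dt β ι (c.1 * ℓ)), ∀ w ∈ placesDividing K c.1,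
      galoisCohomology.localization ((W.baseChange K).torsionGaloisModule ((p ^ k : ℕ) : ℤ))
          (Sum.inr w) 1 (d'.kolyvaginClass (Fact.out : p.Prime) k) ∈
        ⨅ ℓ' ∈ c.1.primeFactors.filter (fun ℓ' : ℕ ↦ ((ℓ' : ℕ) : 𝓞 K) ∈ w.asIdeal),
          ⨅ (w' : HeightOneSpectrum (𝓞 (ringClassField K ι ℓ'))) (_ : w'.asIdeal.LiesOver w.asIdeal),
            letI := (adicCompletionOfLiesOver K (ringClassField K ι ℓ') w w').toAlgebra
            transverseSubgroup (GaloisRep.toLocal w ((W.baseChange K).torsionGaloisModule ((p ^ k : ℕ) : ℤ)))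
              (w'.adicCompletion (ringClassField K ι ℓ'))) :
    (((W.baseChange K).baseChange (v₀.adicCompletion K)).localTamagawaNumber
      (v₀.adicCompletionIntegers K)).factorization p ≤ mInf := by
  have hp : p.Prime := Fact.out
  have hc0' : c.1 ≠ 0 := c.2.1.ne_zero
  -- the Weil datum (theorem)
  have h2 : 2 ≤ p ^ k := by
    calc 2 ≤ p := hp.two_le
      _ = p ^ 1 := (pow_one p).symm
      _ ≤ p ^ k := Nat.pow_le_pow_right hp.pos hk
  obtain ⟨e, hμ, hadd₁, hadd₂, hgal, halt, hnondeg, hτe⟩ := exists_weilDatum_liftAut W τ (p ^ k) h2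
  -- the intrinsic transverse family with its reconciliation (theorem)
  obtain ⟨𝒯, h𝒯, hT⟩ := exists_localTransverseFamily W ι ((p ^ k : ℕ) : ℤ) hc0'
  exact tamagawaExponent_le_mInfty_of_localInputs_stringent h44 W hcm K hK hD3 hD4 hH hPT p hp2 htower Dt
    β ι τ hτ hτ2 ε hε h53 hcop' hGZ mdiv m hmdiv hm k hn c hk hcore mInf hmc hkM hik v₀ hv₀ hv₀N hc0 htk
    e hμ hadd₁ hadd₂ hgal halt hnondeg hτe 𝒯 hT (h𝒯σ 𝒯 h𝒯)
    (fun inv hinv v hv ↦ h𝒯sd 𝒯 h𝒯 e hμ hadd₁ hadd₂ hgal halt hnondeg inv hinv v hv) h𝒮σ hloc htr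
    h49str (fun ℓ h1 h2 h3 d' w hw ↦ by rw [h𝒯 w]; exact h49tr ℓ h1 h2 h3 d' w hw)

end Summit.BirchSwinnertonDyer.Rank1Residual.JET

end
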